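import Summits.BirchSwinnertonDyer.BirchSwinnertonDyer.Theorems.AdditiveKolyvaginRoadLevelSystemsDichotomyTwoStepOfPoitouTate
import Summits.BirchSwinnertonDyer.BirchSwinnertonDyer.Theorems.AdditiveKolyvaginRoadLevelSystemsDichotomyRaiseOfPoitouTate
import Summits.BirchSwinnertonDyer.BirchSwinnertonDyer.Theorems.AdditiveKolyvaginRoadLevelSystemsDichotomyLowerOfLocalPackage
import Summits.BirchSwinnertonDyer.BirchSwinnertonDyer.Theorems.AdditiveKolyvaginRoadKolyvaginSupplyOfPoitouTate
import HarnessLib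

/-!
# Route `AdditiveKolyvaginRoad`, crux `LevelKolyvaginSystemsAdditive` (item stmt-BirchSwinnertonDyer-21396, KS′):
# the E-side binder (DICH) of the synthetic level Kolyvagin system DISCHARGED modulo the Poitou–Tate fact
# (cell `pub/bsd-wall`, width seat `bsd-wall-akr-p2x-w5` g0; `--supports stmt-BirchSwinnertonDyer-21396`, helper; assembly of
# p625481 (Lower), p628088 (Raise, width seat w3), p630671 (TwoStep, this seat); route-independent — the by-name door
# `(∀ K, PT K) → KolyvaginPrimitiveAdditive → LevelKolyvaginSystemsAdditive` is the sibling
# `…LevelKolyvaginSystemsAdditiveOfKolyvaginPrimitiveOfPoitouTate`)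

WHAT.
* `selmerDichotomy_of_poitouTate` — at a ♯-type frame (`K` imaginary quadratic, `d_K < −4`, `p` odd, `ρ̄_{E,p}` onto,
  `c ≠ 1`) and granted `poitouTate_selmerStructure_duality K`, EVERY family `𝒮 n m μ` with the membership dictionary of the
  level-`n` `μ`-eigen Selmer space of `E[p]` transverse on `m` satisfies the three E-side dichotomies of the synthetic system:
  (Lower) [`selmerDichotomy_lower_of_localPackage` on the package `kolyvaginLocalPackageP_of_poitouTate`], (Raise) parity-free
  [`selmerDichotomy_raise_of_poitouTate'`], (TwoStep) [`selmerDichotomy_twoStep_of_poitouTate`]; finiteness of the family is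
  automatic (`moduleFinite_of_levelDictionary`), the local `ZMod p`-structures and compactness are supplied in the kernel.
* `dich_of_poitouTate` — the displayed ∀-frame binder (DICH) of `levelKolyvaginSystemsAdditive_of_kolyvaginPrimitiveAdditive`
  (p624986) VERBATIM, from `∀ K, poitouTate_selmerStructure_duality K` (the second conjunct of the route's DUAL bundle
  `PublishedDualityInputsAdditiveKoly`).

HONEST FRAMING: two theorems; 0 definitions, 0 named facts, 0 `sorry`; CONDITIONAL on the named Poitou–Tate fact; closes
nothing. BSD is not proved by any of this; KS′ and KPA′ stay OPEN at `p² ∣ N`.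

References: [cite: WZhang2014, Lemma 5.3, Prop. 5.4, §8.1, Lemma 8.2, Lemma 8.4] [cite: MazurRubin2004, Lemma 4.1.7]
[cite: MilneADT2006, Ch. I, Cor. 2.3, Thm. 4.10] [cite: BertoliniDarmon2005, Lemma 2.6] [cite: GrossLMS1991, §5 (5.1), Prop. 8.1].
-/

-- single-conjunct summit: `Summit.BirchSwinnertonDyer.BirchSwinnertonDyer.…` repeats the name by design
set_option linter.dupNamespace false

noncomputable section

open scoped Classical

namespace Summit.BirchSwinnertonDyer.BirchSwinnertonDyer.Theorems.AdditiveKoly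

open Function WeierstrassCurve NumberField IsDedekindDomain Field
  Literature.NumberTheory.EllipticCurves Literature.NumberTheory.EllipticCurves.ModularForms
  Literature.NumberTheory.EllipticCurves.Rank1Residual Literature.NumberTheory.GaloisRepresentations Module
open Literature.NumberTheory.GaloisCohomology
open Summit.BirchSwinnertonDyer.Rank1Residual.X11b.Three.Koly.Method2
open Summit.BirchSwinnertonDyer.Rank1Residual.X11b Summit.BirchSwinnertonDyer.Rank1Residual.GaloisImage
open Summit.BirchSwinnertonDyer.Rank1Residual.X11b.Three.Koly

variable (W : WeierstrassCurve ℚ) (K : Type) [Field K] [NumberField K] (p : ℕ) [W.IsElliptic] [W.IsGloballyMinimal]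
  [Fact p.Prime] (ι : K →+* ℂ) (c : K ≃ₐ[ℚ] K) [Module (ZMod p) (Vp W K p)]

/-! ## §1 The three dichotomies at a frame, from the Poitou–Tate fact -/

/-- **(DICH) at a frame from Poitou–Tate**: for `K` imaginary quadratic with `d_K < −4`, `p` odd, `ρ̄_{E,p}` onto, `c ≠ 1`
and `poitouTate_selmerStructure_duality K`, every family `𝒮` with the membership dictionary satisfies (Lower) ∧ (Raise)
(parity-free) ∧ (TwoStep). Assembly of `selmerDichotomy_lower_of_localPackage` (package `kolyvaginLocalPackageP_of_poitouTate`),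
`selmerDichotomy_raise_of_poitouTate'` and `selmerDichotomy_twoStep_of_poitouTate`, with finiteness by
`moduleFinite_of_levelDictionary` and the instance binders supplied here. [cite: MazurRubin2004, Lemma 4.1.7]
[cite: WZhang2014, Lemma 5.3, Prop. 5.4, Lemma 8.2, Lemma 8.4] -/
theorem selmerDichotomy_of_poitouTate (hK : IsImaginaryQuadratic K) (hp2 : p ≠ 2) (hd : NumberField.discr K < -4)
    (hsurj : W.HasSurjectiveModNGaloisRep p) (hc1 : c ≠ 1) (hPT : poitouTate_selmerStructure_duality K)
    (𝒮 : Finset (AdmQ W K p) → Finset {ℓ // Zhang2014.IsKolyvaginPrime (W.conductorNorm ℤ) W K p ℓ} → Bool →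
      Submodule (ZMod p) (Vp W K p))
    (h𝒮 : ∀ (n : Finset (AdmQ W K p)) (m : Finset {ℓ // Zhang2014.IsKolyvaginPrime (W.conductorNorm ℤ) W K p ℓ})
      (μ : Bool) (x : Vp W K p), x ∈ 𝒮 n m μ ↔
        conjAct W c ((p ^ 1 : ℕ) : ℤ) x = sgnP μ • x ∧
        (∀ w : InfinitePlace K, x ∈ selmerLocalKer (W.baseChange K) w.Completion ((p ^ 1 : ℕ) : ℤ)) ∧
        (∀ v : HeightOneSpectrum (𝓞 K), (∀ ℓ ∈ m, ((ℓ : ℕ) : 𝓞 K) ∉ v.asIdeal) → (∀ q ∈ n, ((q : ℕ) : 𝓞 K) ∉ v.asIdeal) →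
          x ∈ selmerLocalKer (W.baseChange K) (v.adicCompletion K) ((p ^ 1 : ℕ) : ℤ)) ∧
        (∀ q ∈ n, ∀ v : HeightOneSpectrum (𝓞 K), ((q : ℕ) : 𝓞 K) ∈ v.asIdeal →
          x ∈ toricLocalKer (W.baseChange K) (v.adicCompletion K) ((p ^ 1 : ℕ) : ℤ)) ∧
        (∀ ℓ ∈ m, ∀ v : HeightOneSpectrum (𝓞 K), ((ℓ : ℕ) : 𝓞 K) ∈ v.asIdeal → x ∈ transverseLocalKerP W K p ι ℓ v)) :
    (∀ (n : Finset (AdmQ W K p)) (m : Finset {ℓ // Zhang2014.IsKolyvaginPrime (W.conductorNorm ℤ) W K p ℓ})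
        (ℓ : {ℓ // Zhang2014.IsKolyvaginPrime (W.conductorNorm ℤ) W K p ℓ}) (μ : Bool) (v : HeightOneSpectrum (𝓞 K)),
        ℓ ∉ m → ((ℓ : ℕ) : 𝓞 K) ∈ v.asIdeal →
        (∃ x ∈ 𝒮 n m μ, x ∉ (W.baseChange K).torsionLocalKer (v.adicCompletion K) ((p ^ 1 : ℕ) : ℤ)) →
        (∀ y ∈ 𝒮 n (insert ℓ m) μ, y ∈ (W.baseChange K).torsionLocalKer (v.adicCompletion K) ((p ^ 1 : ℕ) : ℤ)) ∧
          finrank (ZMod p) (𝒮 n (insert ℓ m) μ) + 1 = finrank (ZMod p) (𝒮 n m μ)) ∧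
    (∀ (n : Finset (AdmQ W K p)), n.Nonempty →
      ∀ (m : Finset {ℓ // Zhang2014.IsKolyvaginPrime (W.conductorNorm ℤ) W K p ℓ})
        (ℓ : {ℓ // Zhang2014.IsKolyvaginPrime (W.conductorNorm ℤ) W K p ℓ}) (μ : Bool) (v : HeightOneSpectrum (𝓞 K)),
        ℓ ∉ m → ((ℓ : ℕ) : 𝓞 K) ∈ v.asIdeal →
        (∀ x ∈ 𝒮 n m μ, x ∈ (W.baseChange K).torsionLocalKer (v.adicCompletion K) ((p ^ 1 : ℕ) : ℤ)) →
        finrank (ZMod p) (𝒮 n (insert ℓ m) μ) = finrank (ZMod p) (𝒮 n m μ) + 1) ∧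
    (∀ (n : Finset (AdmQ W K p)) (q₁ q₂ : AdmQ W K p), n.Nonempty → Even n.card → q₁ ∉ n → q₂ ∉ insert q₁ n →
      ∀ (m : Finset {ℓ // Zhang2014.IsKolyvaginPrime (W.conductorNorm ℤ) W K p ℓ}) (μ : Bool),
        finrank (ZMod p) (𝒮 (insert q₂ (insert q₁ n)) m true) +
            finrank (ZMod p) (𝒮 (insert q₂ (insert q₁ n)) m false) = 1 →
        (∃ g ∈ 𝒮 (insert q₂ (insert q₁ n)) m μ, ∃ v : HeightOneSpectrum (𝓞 K), ((q₂ : ℕ) : 𝓞 K) ∈ v.asIdeal ∧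
          g ∉ (W.baseChange K).torsionLocalKer (v.adicCompletion K) ((p ^ 1 : ℕ) : ℤ)) →
        finrank (ZMod p) (𝒮 n m true) + finrank (ZMod p) (𝒮 n m false) = 1) := by
  have hp : p.Prime := Fact.out
  haveI : NeZero (p ^ 1 : ℕ) := ⟨pow_ne_zero 1 hp.ne_zero⟩
  -- the instance binders of the three discharges, supplied in the kernel (the tree's standard recipe)
  letI : ∀ v : Place K, Module (ZMod p)
      (galoisCohomology (((W.baseChange K).torsionGaloisModule ((p ^ 1 : ℕ) : ℤ)).toLocal v) 1) := fun v ↦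
    AddCommGroup.zmodModule (fun x ↦ by
      have h := galoisCohomology.nsmul_eq_zero_of_forall
        (((W.baseChange K).torsionGaloisModule ((p ^ 1 : ℕ) : ℤ)).toLocal v) (n := p ^ 1)
        (fun m => AddSubgroup.torsionBy.nsmul m) x
      simpa using h)
  haveI : ∀ v : Place K, CompactSpace (absoluteGaloisGroup (Place.Completion v)) := fun v ↦
    absoluteGaloisGroup_compactSpace _
  haveI : Finite (geomTorsion (W.baseChange K) ((p ^ 1 : ℕ) : ℤ)) :=
    finite_geomTorsion_of_neZero (W.baseChange K) (p ^ 1)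
  have hfin := moduleFinite_of_levelDictionary W K p ι c 𝒮 h𝒮
  obtain ⟨Lp⟩ := kolyvaginLocalPackageP_of_poitouTate W K p ι c hK hp2 hd hsurj hc1 hPT
  exact ⟨selmerDichotomy_lower_of_localPackage W K p ι c Lp 𝒮 h𝒮 hfin,
    selmerDichotomy_raise_of_poitouTate' W K p ι c hK hp2 hd hsurj hc1 hPT 𝒮 h𝒮 hfin,
    selmerDichotomy_twoStep_of_poitouTate W K p ι c hK hp2 hd hc1 hPT 𝒮 h𝒮⟩

/-! ## §2 (DICH) verbatim -/

/-- **The ∀-frame binder (DICH) of `levelKolyvaginSystemsAdditive_of_kolyvaginPrimitiveAdditive`, from the Poitou–Tate fact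
for every imaginary quadratic field** (stated, as in the route's DUAL bundle, for every number field). At a ♯-type frame
`p ≥ 5` is odd; the three conjuncts are `selmerDichotomy_of_poitouTate` (the idle `Even n.card` ∕ `n.Nonempty` guards of
(Lower) ∕ (Raise) are discarded). [cite: MazurRubin2004, Lemma 4.1.7] [cite: WZhang2014, Lemma 5.3, Prop. 5.4, Lemma 8.2, Lemma 8.4] -/
theorem dich_of_poitouTate
    (hPT : ∀ (K : Type) [Field K] [NumberField K], poitouTate_selmerStructure_duality K) :
    ∀ (W : WeierstrassCurve ℚ) [W.IsElliptic] [W.IsGloballyMinimal] [NeZero (W.conductorNorm ℤ)] (p : ℕ)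
      [Fact p.Prime] (K : Type) [Field K] [NumberField K] (ι : K →+* ℂ) (c : K ≃ₐ[ℚ] K) [Module (ZMod p) (Vp W K p)],
      5 ≤ p → W.HasSurjectiveModNGaloisRep p → IsImaginaryQuadratic K → Odd (NumberField.discr K) →
      NumberField.discr K < -4 → c ≠ 1 →
      ∀ 𝒮 : Finset (AdmQ W K p) → Finset {ℓ // Zhang2014.IsKolyvaginPrime (W.conductorNorm ℤ) W K p ℓ} → Bool →
        Submodule (ZMod p) (Vp W K p),
      (∀ (n : Finset (AdmQ W K p)) (m : Finset {ℓ // Zhang2014.IsKolyvaginPrime (W.conductorNorm ℤ) W K p ℓ})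
          (μ : Bool) (x : Vp W K p), x ∈ 𝒮 n m μ ↔
            conjAct W c ((p ^ 1 : ℕ) : ℤ) x = sgnP μ • x ∧
            (∀ w : InfinitePlace K, x ∈ selmerLocalKer (W.baseChange K) w.Completion ((p ^ 1 : ℕ) : ℤ)) ∧
            (∀ v : HeightOneSpectrum (𝓞 K), (∀ ℓ ∈ m, ((ℓ : ℕ) : 𝓞 K) ∉ v.asIdeal) → (∀ q ∈ n, ((q : ℕ) : 𝓞 K) ∉ v.asIdeal) →
              x ∈ selmerLocalKer (W.baseChange K) (v.adicCompletion K) ((p ^ 1 : ℕ) : ℤ)) ∧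
            (∀ q ∈ n, ∀ v : HeightOneSpectrum (𝓞 K), ((q : ℕ) : 𝓞 K) ∈ v.asIdeal →
              x ∈ toricLocalKer (W.baseChange K) (v.adicCompletion K) ((p ^ 1 : ℕ) : ℤ)) ∧
            (∀ ℓ ∈ m, ∀ v : HeightOneSpectrum (𝓞 K), ((ℓ : ℕ) : 𝓞 K) ∈ v.asIdeal → x ∈ transverseLocalKerP W K p ι ℓ v)) →
      (∀ (n : Finset (AdmQ W K p)), n.Nonempty → Even n.card →
          ∀ (m : Finset {ℓ // Zhang2014.IsKolyvaginPrime (W.conductorNorm ℤ) W K p ℓ})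
            (ℓ : {ℓ // Zhang2014.IsKolyvaginPrime (W.conductorNorm ℤ) W K p ℓ}) (μ : Bool) (v : HeightOneSpectrum (𝓞 K)),
            ℓ ∉ m → ((ℓ : ℕ) : 𝓞 K) ∈ v.asIdeal →
            (∃ x ∈ 𝒮 n m μ, x ∉ (W.baseChange K).torsionLocalKer (v.adicCompletion K) ((p ^ 1 : ℕ) : ℤ)) →
            (∀ y ∈ 𝒮 n (insert ℓ m) μ, y ∈ (W.baseChange K).torsionLocalKer (v.adicCompletion K) ((p ^ 1 : ℕ) : ℤ)) ∧
              finrank (ZMod p) (𝒮 n (insert ℓ m) μ) + 1 = finrank (ZMod p) (𝒮 n m μ)) ∧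
      (∀ (n : Finset (AdmQ W K p)), n.Nonempty → Even n.card →
          ∀ (m : Finset {ℓ // Zhang2014.IsKolyvaginPrime (W.conductorNorm ℤ) W K p ℓ})
            (ℓ : {ℓ // Zhang2014.IsKolyvaginPrime (W.conductorNorm ℤ) W K p ℓ}) (μ : Bool) (v : HeightOneSpectrum (𝓞 K)),
            ℓ ∉ m → ((ℓ : ℕ) : 𝓞 K) ∈ v.asIdeal →
            (∀ x ∈ 𝒮 n m μ, x ∈ (W.baseChange K).torsionLocalKer (v.adicCompletion K) ((p ^ 1 : ℕ) : ℤ)) →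
            finrank (ZMod p) (𝒮 n (insert ℓ m) μ) = finrank (ZMod p) (𝒮 n m μ) + 1) ∧
      (∀ (n : Finset (AdmQ W K p)) (q₁ q₂ : AdmQ W K p), n.Nonempty → Even n.card → q₁ ∉ n → q₂ ∉ insert q₁ n →
          ∀ (m : Finset {ℓ // Zhang2014.IsKolyvaginPrime (W.conductorNorm ℤ) W K p ℓ}) (μ : Bool),
            finrank (ZMod p) (𝒮 (insert q₂ (insert q₁ n)) m true) + finrank (ZMod p) (𝒮 (insert q₂ (insert q₁ n)) m false) = 1 →
            (∃ g ∈ 𝒮 (insert q₂ (insert q₁ n)) m μ, ∃ v : HeightOneSpectrum (𝓞 K), ((q₂ : ℕ) : 𝓞 K) ∈ v.asIdeal ∧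
              g ∉ (W.baseChange K).torsionLocalKer (v.adicCompletion K) ((p ^ 1 : ℕ) : ℤ)) →
            finrank (ZMod p) (𝒮 n m true) + finrank (ZMod p) (𝒮 n m false) = 1) := by
  intro W _ _ _ p _ K _ _ ι c _ h5 hsurj hK _ hlt hc1 𝒮 h𝒮
  have hp2 : p ≠ 2 := by omega
  obtain ⟨hL, hR, hT⟩ := selmerDichotomy_of_poitouTate W K p ι c hK hp2 hlt hsurj hc1 (hPT K) 𝒮 h𝒮
  exact ⟨fun n _ _ m ℓ μ v ↦ hL n m ℓ μ v, fun n hn _ ↦ hR n hn, hT⟩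

end Summit.BirchSwinnertonDyer.BirchSwinnertonDyer.Theorems.AdditiveKoly

end
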